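import Literature.Algebra.Homology.CartanCriterion
import HarnessLib

/-!
# The Čech complex of a finite family of arrows: the section model

For a family of arrows `(f_a : V_a → U)_{a ∈ A}` in a category with finite wide pullbacks, the
Čech complex `Č•(𝔙, P) = Hom(ℤ[N(𝔙)]_•, P)` of an abelian presheaf `P` (`CechNerve.lean`,
`CartanCriterion.lean`) is identified with the complex of *families of sections*
`(s_k ∈ P(V_{k₀} ×_U ⋯ ×_U V_{kₘ}))_{k : Fin (m+1) → A}` with differential the alternating sum of
the restrictions along the face maps (`cechδ`, `cechD`) — Milne's `C•(𝒰, P)`: a cochain is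
determined by its values on the universal simplices over the wide pullbacks (`cechSection`,
`cechSectionCochain`, mutually inverse), compatibly with the differentials (`cechSection_d`,
`cechSectionCochain_cechD`), so that exactness in positive degrees can be checked on families of
sections (`cechCochainComplex_exactAt_succ_iff_sections`). This is the form in which the Čech
complexes of `ν*F` on a presented pro-étale cover are computed as filtered colimits of étale
Čech complexes in the proof of Bhatt–Scholze Cor. 5.1.6
(`Literature/AlgebraicGeometry/Motives/EtaleToProetCechCover.lean`).

## References

* J. S. Milne, *Étale cohomology* (2025 reissue): III §2, the complex `C•(𝒰, P)` with
  `Cⁿ = ∏ P(U_{i₀…iₙ})` (held copy PDF pp. 104–109). [Milne2025]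

## Design notes

* Everything lives in the sub-namespace `CechFamily` (the one-arrow special case with the same
  short names is `CechOneArrow.lean`).
* The index computations must be *reducible* for rewriting along the comparison: `faceMap i` is
  the function of `SimplexCategory.δ i` (so the index map of a face is definitionally the
  composite), and `simplexIndex`, `face`, `universalSimplex` are reducible copies of
  `cechSimplexIndex`, `cechFace`, `cechUniversalSimplex` (equal to them by `rfl`).
* `cechD` is stated for presheaves with coefficients in any universe; the comparison with the
  nerve model needs coefficients `Ab.{max w v}` as in `CechNerve.lean`.
* Only theorems and real definitions; no named facts (D-0026). Mathlib searched:
  `SheafCohomology/Cech.lean` (`cechComplex` via finite products of objects; no comparison with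
  nerves). Nothing restated.
-/

universe w' w v u

open CategoryTheory Opposite Limits Abelian Simplicial

namespace Literature.Algebra.Homology.CechFamily

open Literature.Algebra.Homology

/-! ### The section model of the Čech complex of a finite family of arrows

For a family of arrows `(f_a : V_a → U)_{a ∈ A}` in a category with finite wide pullbacks, Čech
`m`-cochains of an abelian presheaf `P` are families of sections of `P` over the wide pullbacks
`V_{k₀} ×_U ⋯ ×_U V_{kₘ}`, `k : Fin (m+1) → A`, and the Čech differential is the alternating sum of
the restrictions along the face maps. -/

section FiniteFamily

variable {C : Type u} [Category.{v} C] [HasFiniteWidePullbacks C] {A : Type w} {U : C} {V : A → C}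
  (f : ∀ a, V a ⟶ U)

/-- The map of finite sets underlying the `i`-th face (the function of `SimplexCategory.δ i`, so
that the index map of the `i`-th face of a simplex is *definitionally* the composite with it).
[folklore] -/
abbrev faceMap {m : ℕ} (i : Fin (m + 2)) : Fin (m + 1) → Fin (m + 2) := (SimplexCategory.δ i).toOrderHom

omit [HasFiniteWidePullbacks C] in
/-- `faceMap i` is `Fin.succAbove i`. [folklore] -/
lemma faceMap_apply {m : ℕ} (i : Fin (m + 2)) (a : Fin (m + 1)) : faceMap i a = Fin.succAbove i a := by
  simp [faceMap, SimplexCategory.δ]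

omit [HasFiniteWidePullbacks C] in
/-- The index map `a ↦ k_a` of a simplex (reducible version of `cechSimplexIndex`). [folklore] -/
abbrev simplexIndex {m : ℕ} {T : Cᵒᵖ} (x : (cechSimplex f m).obj T) : Fin (m + 1) → A :=
  fun a => (x.1 a).1

omit [HasFiniteWidePullbacks C] in
/-- `simplexIndex` is `cechSimplexIndex` (by `rfl`). [folklore] -/
lemma simplexIndex_eq {m : ℕ} {T : Cᵒᵖ} (x : (cechSimplex f m).obj T) :
    simplexIndex f x = cechSimplexIndex f x := rfl

omit [HasFiniteWidePullbacks C] in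
/-- The `i`-th face of a simplex (reducible version of `cechFace`: delete the `i`-th entry).
[folklore] -/
abbrev face {m : ℕ} (i : Fin (m + 2)) {T : Cᵒᵖ} (x : (cechSimplex f (m + 1)).obj T) :
    (cechSimplex f m).obj T :=
  ⟨fun a => x.1 (faceMap i a), fun _ _ => x.2 _ _⟩

omit [HasFiniteWidePullbacks C] in
/-- `cechFace` is `face` (by `rfl`). [folklore] -/
lemma cechFace_eq_face {m : ℕ} (i : Fin (m + 2)) (T : Cᵒᵖ) (x : (cechSimplex f (m + 1)).obj T) :
    cechFace f m i T x = face f i x := rfl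

omit [HasFiniteWidePullbacks C] in
/-- The Čech differential on simplices, with the reducible faces. [folklore] -/
lemma cechEval_d_face {P : Cᵒᵖ ⥤ AddCommGrpCat.{max w v}} {m : ℕ} (φ : (cechNerveComplex f).X m ⟶ P)
    (T : Cᵒᵖ) (x : (cechSimplex f (m + 1)).obj T) :
    cechEval f ((cechCochainComplex f P).d m (m + 1) φ) T x =
      ∑ i : Fin (m + 2), ((-1 : ℤ) ^ (i : ℕ)) • cechEval f φ T (face f i x) :=
  cechEval_d f φ T x

/-- The `i`-th face map `V_{k₀} ×_U ⋯ ×_U V_{kₘ₊₁} → V_{k_{δᵢ0}} ×_U ⋯ ×_U V_{k_{δᵢm}}` (omit the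
`i`-th factor). [folklore] -/
noncomputable def cechδ {m : ℕ} (kk : Fin (m + 2) → A) (i : Fin (m + 2)) :
    cechWidePullback f kk ⟶ cechWidePullback f (fun a => kk (faceMap i a)) :=
  WidePullback.lift (WidePullback.base _) (fun a => WidePullback.π _ (faceMap i a))
    (fun _ => WidePullback.π_arrow _ _)

/-- A face map followed by a projection. [folklore] -/
@[reassoc]
lemma cechδ_π {m : ℕ} (kk : Fin (m + 2) → A) (i : Fin (m + 2)) (a : Fin (m + 1)) :
    cechδ f kk i ≫ WidePullback.π (fun a => f (kk (faceMap i a))) a = WidePullback.π _ (faceMap i a) :=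
  WidePullback.lift_π _ _ _ _ _

/-- A face map followed by the base map. [folklore] -/
@[reassoc]
lemma cechδ_base {m : ℕ} (kk : Fin (m + 2) → A) (i : Fin (m + 2)) :
    cechδ f kk i ≫ WidePullback.base (fun a => f (kk (faceMap i a))) = WidePullback.base _ :=
  WidePullback.lift_base _ _ _ _

section Sections

universe w₀

variable (P : Cᵒᵖ ⥤ AddCommGrpCat.{w₀})

/-- **The Čech differential on families of sections** over the wide pullbacks:
`(D s)_k = Σᵢ (-1)ⁱ δᵢ^* s_{k ∘ δᵢ}`. [folklore] -/
noncomputable def cechD (m : ℕ) (s : ∀ kk : Fin (m + 1) → A, P.obj (op (cechWidePullback f kk)))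
    (kk : Fin (m + 2) → A) : P.obj (op (cechWidePullback f kk)) :=
  ∑ i : Fin (m + 2), ((-1 : ℤ) ^ (i : ℕ)) • P.map (cechδ f kk i).op (s (fun a => kk (faceMap i a)))

/-- `cechD` is additive. [folklore] -/
lemma cechD_add (m : ℕ) (s s' : ∀ kk : Fin (m + 1) → A, P.obj (op (cechWidePullback f kk))) :
    cechD f P m (s + s') = cechD f P m s + cechD f P m s' := by
  funext kk
  simp only [cechD, Pi.add_apply, map_add, smul_add, Finset.sum_add_distrib]

/-- `cechD 0 = 0`. [folklore] -/
lemma cechD_zero (m : ℕ) : cechD f P m 0 = 0 := by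
  funext kk
  simp only [cechD, Pi.zero_apply, map_zero, smul_zero, Finset.sum_const_zero]

variable {P}

/-- `cechD` is natural in the presheaf. [folklore] -/
lemma cechD_map {P' : Cᵒᵖ ⥤ AddCommGrpCat.{w₀}} (η : P ⟶ P') (m : ℕ)
    (s : ∀ kk : Fin (m + 1) → A, P.obj (op (cechWidePullback f kk))) (kk : Fin (m + 2) → A) :
    cechD f P' m (fun kk => η.app _ (s kk)) kk = η.app _ (cechD f P m s kk) := by
  simp only [cechD, map_sum, map_zsmul]
  refine Finset.sum_congr rfl fun i _ => ?_
  rw [NatTrans.naturality_apply]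

end Sections

/-- The universal simplex `(k_a, π_a)_a` over `V_{k₀} ×_U ⋯ ×_U V_{kₘ}` (reducible version of
`cechUniversalSimplex`). [folklore] -/
noncomputable abbrev universalSimplex {m : ℕ} (kk : Fin (m + 1) → A) :
    (cechSimplex f m).obj (op (cechWidePullback f kk)) :=
  ⟨fun a => ⟨kk a, WidePullback.π _ a⟩, fun a b => by
    simp only [cechBase_apply]
    rw [WidePullback.π_arrow, WidePullback.π_arrow]⟩

/-- `universalSimplex` is `cechUniversalSimplex` (by `rfl`). [folklore] -/
lemma universalSimplex_eq {m : ℕ} (kk : Fin (m + 1) → A) :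
    universalSimplex f kk = cechUniversalSimplex f kk := rfl

/-- The classifying morphism `T → V_{k₀} ×_U ⋯ ×_U V_{kₘ}` of a simplex with index map `k`.
[folklore] -/
noncomputable abbrev classify {m : ℕ} {T : C} (x : (cechSimplex f m).obj (op T)) :
    T ⟶ cechWidePullback f (simplexIndex f x) :=
  cechSimplexLift f (simplexIndex f x) x (fun _ => rfl)

/-- A simplex is the pullback of the universal simplex along its classifying morphism.
[folklore] -/
lemma cechSimplex_map_classify {m : ℕ} {T : C} (x : (cechSimplex f m).obj (op T)) :
    (cechSimplex f m).map (classify f x).op (universalSimplex f (simplexIndex f x)) = x :=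
  cechSimplex_map_cechSimplexLift f _ x _

/-- The classifying morphism is natural in `T`. [folklore] -/
lemma classify_map {m : ℕ} {T T' : C} (τ : T' ⟶ T) (x : (cechSimplex f m).obj (op T)) :
    classify f ((cechSimplex f m).map τ.op x) = τ ≫ classify f x :=
  cechSimplexLift_map f _ τ x _

/-- The classifying morphism followed by a projection is the corresponding entry. [folklore] -/
lemma classify_π {m : ℕ} {T : C} (x : (cechSimplex f m).obj (op T)) (a : Fin (m + 1)) :
    classify f x ≫ WidePullback.π (fun a => f (simplexIndex f x a)) a = (x.1 a).2 := by
  unfold classify cechSimplexLift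
  rw [WidePullback.lift_π]
  simp only [eqToHom_refl, Category.comp_id]

/-- The classifying morphism followed by the base map. [folklore] -/
lemma classify_base {m : ℕ} {T : C} (x : (cechSimplex f m).obj (op T)) :
    classify f x ≫ WidePullback.base (fun a => f (simplexIndex f x a)) = (x.1 0).2 ≫ f _ :=
  WidePullback.lift_base _ _ _ _

/-- The classifying morphism of a face is the classifying morphism followed by the face map.
[folklore] -/
lemma classify_face {m : ℕ} {T : C} (i : Fin (m + 2)) (x : (cechSimplex f (m + 1)).obj (op T)) :
    classify f (face f i x) = classify f x ≫ cechδ f (simplexIndex f x) i := by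
  apply WidePullback.hom_ext
  · intro a
    rw [Category.assoc, cechδ_π, classify_π, classify_π]
  · rw [Category.assoc, cechδ_base, classify_base, classify_base]
    exact x.2 _ _

/-- The classifying morphism of the universal simplex is the identity. [folklore] -/
lemma classify_universalSimplex {m : ℕ} (kk : Fin (m + 1) → A) :
    classify f (universalSimplex f kk) = 𝟙 (cechWidePullback f kk) := by
  apply WidePullback.hom_ext
  · intro a
    rw [classify_π, Category.id_comp]
  · rw [classify_base, Category.id_comp]
    exact WidePullback.π_arrow _ _

variable (P : Cᵒᵖ ⥤ AddCommGrpCat.{max w v})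

/-- Naturality of `x ↦ (classify x)^* s_{index x}`. [folklore] -/
lemma map_classify_aux {m : ℕ} (s : ∀ kk : Fin (m + 1) → A, P.obj (op (cechWidePullback f kk)))
    {T T' : Cᵒᵖ} (τ : T ⟶ T') (x : (cechSimplex f m).obj T) :
    P.map τ (P.map (classify f (T := T.unop) x).op (s (simplexIndex f x))) =
      P.map (classify f (T := T'.unop) ((cechSimplex f m).map τ x)).op
        (s (simplexIndex f ((cechSimplex f m).map τ x))) := by
  change (P.map _ ≫ P.map τ) _ = _
  rw [← P.map_comp]
  change P.map (τ.unop ≫ classify f x).op _ = _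
  rw [← classify_map]
  rfl

/-- **The cochain of a family of sections**: `(s_k)_k` defines the Čech `m`-cochain
`x ↦ (classify x)^* s_{index x}`. [folklore] -/
noncomputable def cechSectionCochain (m : ℕ)
    (s : ∀ kk : Fin (m + 1) → A, P.obj (op (cechWidePullback f kk))) : (cechNerveComplex f).X m ⟶ P :=
  cechLift f (fun T x => P.map (classify f (T := T.unop) x).op (s (simplexIndex f x)))
    (fun τ x => map_classify_aux f P s τ x)

/-- Values of the cochain of a family of sections. [folklore] -/
@[simp] lemma cechEval_cechSectionCochain (m : ℕ)
    (s : ∀ kk : Fin (m + 1) → A, P.obj (op (cechWidePullback f kk))) (T : Cᵒᵖ)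
    (x : (cechSimplex f m).obj T) :
    cechEval f (cechSectionCochain f P m s) T x =
      P.map (classify f (T := T.unop) x).op (s (simplexIndex f x)) :=
  cechEval_cechLift _ _ (fun τ x => map_classify_aux f P s τ x) T x

/-- **The family of sections of a cochain**: its values on the universal simplices. [folklore] -/
noncomputable def cechSection (m : ℕ) (φ : (cechNerveComplex f).X m ⟶ P) (kk : Fin (m + 1) → A) :
    P.obj (op (cechWidePullback f kk)) :=
  cechEval f φ _ (universalSimplex f kk)

/-- `cechSection` is additive. [folklore] -/
lemma cechSection_add (m : ℕ) (φ φ' : (cechNerveComplex f).X m ⟶ P) :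
    cechSection f P m (φ + φ') = cechSection f P m φ + cechSection f P m φ' := rfl

/-- `cechSection 0 = 0`. [folklore] -/
lemma cechSection_zero (m : ℕ) : cechSection f P m (0 : (cechNerveComplex f).X m ⟶ P) = 0 := rfl

/-- `section ∘ cochain = id`. [folklore] -/
lemma cechSection_cechSectionCochain (m : ℕ)
    (s : ∀ kk : Fin (m + 1) → A, P.obj (op (cechWidePullback f kk))) :
    cechSection f P m (cechSectionCochain f P m s) = s := by
  funext kk
  unfold cechSection
  rw [cechEval_cechSectionCochain]
  change P.map (classify f (universalSimplex f kk)).op (s kk) = s kk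
  rw [classify_universalSimplex, op_id, P.map_id]
  rfl

/-- `cochain ∘ section = id`: a cochain is determined by its values on the universal simplices.
[folklore] -/
lemma cechSectionCochain_cechSection (m : ℕ) (φ : (cechNerveComplex f).X m ⟶ P) :
    cechSectionCochain f P m (cechSection f P m φ) = φ := by
  apply cech_hom_ext
  intro T x
  rw [cechEval_cechSectionCochain]
  unfold cechSection
  rw [map_cechEval, cechSimplex_map_classify]

/-- **The Čech differential in the section model**: the sections of `dφ` are `D` of the sections
of `φ`. [folklore] -/
theorem cechSection_d (m : ℕ) (φ : (cechNerveComplex f).X m ⟶ P) :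
    cechSection f P (m + 1) ((cechCochainComplex f P).d m (m + 1) φ) = cechD f P m (cechSection f P m φ) := by
  funext kk
  conv_lhs => rw [← cechSectionCochain_cechSection f P m φ]
  unfold cechSection cechD
  rw [cechEval_d_face]
  refine Finset.sum_congr rfl fun i _ => ?_
  rw [cechEval_cechSectionCochain, classify_face, classify_universalSimplex, Category.id_comp]

/-- The cochain of `D s` is `d` of the cochain of `s`. [folklore] -/
theorem cechSectionCochain_cechD (m : ℕ)
    (s : ∀ kk : Fin (m + 1) → A, P.obj (op (cechWidePullback f kk))) :
    cechSectionCochain f P (m + 1) (cechD f P m s) =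
      (cechCochainComplex f P).d m (m + 1) (cechSectionCochain f P m s) := by
  rw [← cechSectionCochain_cechSection f P (m + 1) ((cechCochainComplex f P).d m (m + 1) _),
    cechSection_d, cechSection_cechSectionCochain]

/-- **Čech exactness in the section model.** `Č•(𝔙, P)` is exact in degree `m + 1` iff every family
of sections `s` over the `(m+2)`-fold wide pullbacks with `D s = 0` is `D t` for a family `t` over
the `(m+1)`-fold ones. [folklore] -/
theorem cechCochainComplex_exactAt_succ_iff_sections (m : ℕ) :
    (cechCochainComplex f P).ExactAt (m + 1) ↔
      ∀ s : ∀ kk : Fin (m + 2) → A, P.obj (op (cechWidePullback f kk)), cechD f P (m + 1) s = 0 →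
        ∃ t : ∀ kk : Fin (m + 1) → A, P.obj (op (cechWidePullback f kk)), cechD f P m t = s := by
  rw [(cechCochainComplex f P).exactAt_iff' m (m + 1) (m + 2) (by simp) (by simp),
    ShortComplex.ab_exact_iff]
  constructor
  · intro h s hs
    obtain ⟨ψ, hψ⟩ := h (cechSectionCochain f P (m + 1) s) (by
      change (cechCochainComplex f P).d (m + 1) (m + 2) _ = 0
      rw [← cechSectionCochain_cechD, hs]
      apply cech_hom_ext
      intro T x
      rw [cechEval_cechSectionCochain, Pi.zero_apply, map_zero]
      rfl)
    refine ⟨cechSection f P m ψ, ?_⟩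
    change (cechCochainComplex f P).d m (m + 1) ψ = _ at hψ
    rw [← cechSection_d, hψ, cechSection_cechSectionCochain]
  · intro h φ hφ
    change (cechCochainComplex f P).d (m + 1) (m + 2) φ = 0 at hφ
    obtain ⟨t, ht⟩ := h (cechSection f P (m + 1) φ) (by
      rw [← cechSection_d, hφ]
      rfl)
    refine ⟨cechSectionCochain f P m t, ?_⟩
    change (cechCochainComplex f P).d m (m + 1) _ = φ
    rw [← cechSectionCochain_cechD, ht, cechSectionCochain_cechSection]

end FiniteFamily

end Literature.Algebra.Homology.CechFamily
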